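import Literature.NumberTheory.Rogawski1990.ArchTransfFamilyWeylDischarge        -- ★ p850030 (LH4-p01): `transfFam_eq_zero_of_not_admissible`; brings ★ `ArchTransfFamilyWeyl`∕`Symmetries`∕`ArchTransfFamily`
import Literature.NumberTheory.Rogawski1990.ArchExplicitTransferFactorAtlas        -- ★ p849790∕p849926 (LH4-p03): `archExplicitDelta_endoTorus_gprimeTorus_slotPerm_eq_mul` (Δ″ = K_ρ·τ·D on partner points)
import Literature.NumberTheory.Rogawski1990.ArchHCSpaceG                          -- ★ p849664 (LH3-p02): `ArchHCSpaceG`, `ArchHcJump.order_zero`, `hcNrm`, `hcCayPt`, `HcSemireg`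
import HarnessLib

/-!
# (I₃) for the candidate transfer family — PART 1: the combinatorics of the partner sum at a covered wall (order-agnostic), the resolved form of `transfFamReg`
# on admissible charts, and the order-0 jump bookkeeping (Rogawski 1990 §4.3, §8.2; Shelstad 1979 §4 Lemma 4.2–4.3, Prop. 4.5; Bouaziz 1994 §3.2 (I₃))

Topic `NumberTheory/Rogawski1990`; namespace `Literature.NumberTheory.Rogawski1990`.  THEOREMS ONLY.  Cell `pub/hodgecm-mathlib`, line LH3 (closer stub `stub_N9`, crux H413 =
`stmt-HodgeConjecture-24833`): organ **O-L2 (I₃-TRANSF)** (LH3-plan (g3) DEALER BOARD g3 #1 (iv), RULING #2 (A1)(A2); author LH7-p02 (g2)).  PART 1 = the ORDER-AGNOSTIC partner-sum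
split at a covered wall `w₀ ∉ S` of an admissible `H`-chart `S` (re-indexing of ★ `partnerPerms S` by the slot `(ρ w₀)⁻¹ 1`; the `H`-normal `s + ν • nrm w₀` read on each partner as
the `G′`-normal `hcNrm w₀ k₀ k₂` of the pair of slots carrying `c_{w₀0}, c_{w₀2}`; the Cayley points `hcCayPt w₀ k₀ k₂ (slotPerm ρ s) = slotPerm ρ⁰ (cayPt w₀ s)`), and the
RESOLVED FORM `transfFamReg S c = R_S(c) · w_S · τ·D(endoTorus S c) · Σ_ρ K_ρ · F S (ρ·c) ∕ R′_S(ρ·c)` (★ `archExplicitDelta_endoTorus_gprimeTorus_slotPerm_eq_mul`).  The order-0 jump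
theorem and the higher orders are the next parts.  HONEST LABEL: HC_CM is proved only modulo the 7 printed citations (2 remaining: hLiu418, h413) until rung 0 closes; count-neutral.

## References
* [Shelstad1979] D. Shelstad, *Characters and inner forms of a quasi-split group over ℝ*, Compositio Math. 39 (1979), Lemma 4.2 p. 23, Lemma 4.3 p. 25, Prop. 4.5 p. 26.
* [Rogawski1990] J. D. Rogawski, *Automorphic Representations of Unitary Groups in Three Variables* (1990), §4.3 (4.3.1) p. 43, §8.2 p. 119, §14.6 p. 242.
* [Bouaziz1994IntegralesOrbitales] A. Bouaziz, Ann. Sci. ÉNS 27 (1994), §3.2 (I₃) p. 580.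
-/

set_option autoImplicit false

noncomputable section

open NumberField NumberField.InfinitePlace Matrix Complex Set Filter Topology
open scoped MatrixGroups Matrix Classical Real
open Literature.NumberTheory.Automorphic Literature.NumberTheory.Automorphic.UnitaryGroup Literature.NumberTheory.Automorphic.ArchCartan
open Literature.NumberTheory.GaloisRepresentations

namespace Literature.NumberTheory.Rogawski1990

/-! ## §1 Combinatorics of the partner sum at a wall (order-agnostic) -/

section Comb

variable {W : Type*} [DecidableEq W]

/-- **The `H`-normal read on a partner**: `slotPerm ρ (s + ν • nrm w₀) = slotPerm ρ s + ν • hcNrm w₀ k₀ k₂` with `k₀ = (ρ w₀)⁻¹ 0`, `k₂ = (ρ w₀)⁻¹ 2` the `G′`-slots carrying the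
two `H`-block angles. [cite: Shelstad1979, Lemma 4.2 (p. 23)] -/
theorem slotPerm_add_smul_nrm (ρ : W → Equiv.Perm (Fin 3)) (s : W → Fin 3 → ℝ) (w₀ : W) (ν : ℝ) :
    slotPerm ρ (s + ν • nrm w₀) = slotPerm ρ s + ν • hcNrm w₀ ((ρ w₀).symm 0) ((ρ w₀).symm 2) := by
  funext v j
  simp only [slotPerm_apply, Pi.add_apply, Pi.smul_apply, smul_eq_mul, hcNrm, nrm]
  congr 1
  by_cases hv : v = w₀
  · subst hv
    simp only [Pi.single_eq_same, Pi.sub_apply]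
    have e : ∀ m : Fin 3, (![(1 : ℝ), 0, -1] : Fin 3 → ℝ) m = (Pi.single (0 : Fin 3) (1 : ℝ) : Fin 3 → ℝ) m - (Pi.single (2 : Fin 3) (1 : ℝ) : Fin 3 → ℝ) m := by
      intro m; fin_cases m <;> simp
    rw [e (ρ v j)]
    have h0 : (Pi.single (0 : Fin 3) (1 : ℝ) : Fin 3 → ℝ) (ρ v j) = (Pi.single ((ρ v).symm 0) (1 : ℝ) : Fin 3 → ℝ) j := by
      rw [Pi.single_apply, Pi.single_apply]
      exact if_congr (by rw [Equiv.apply_eq_iff_eq_symm_apply]) rfl rfl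
    have h2 : (Pi.single (2 : Fin 3) (1 : ℝ) : Fin 3 → ℝ) (ρ v j) = (Pi.single ((ρ v).symm 2) (1 : ℝ) : Fin 3 → ℝ) j := by
      rw [Pi.single_apply, Pi.single_apply]
      exact if_congr (by rw [Equiv.apply_eq_iff_eq_symm_apply]) rfl rfl
    rw [h0, h2]
  · simp only [Pi.single_eq_of_ne hv, Pi.zero_apply]

/-- The two `G′`-slots carrying the `H`-block angles are distinct. [cite: Shelstad1979, Lemma 4.2 (p. 23)] -/
theorem symm_zero_ne_symm_two (σ : Equiv.Perm (Fin 3)) : σ.symm 0 ≠ σ.symm 2 := fun h => by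
  have := σ.symm.injective h
  exact absurd this (by decide)

/-- The third slot of the pair `((ρ w₀)⁻¹ 0, (ρ w₀)⁻¹ 2)` is `(ρ w₀)⁻¹ 1`. [cite: Shelstad1979, Lemma 4.2 (p. 23)] -/
theorem hcThird_symm_zero_symm_two (σ : Equiv.Perm (Fin 3)) : hcThird (σ.symm 0) (σ.symm 2) = σ.symm 1 := by
  -- `hcThird i j = -(i + j)`; the three values `σ⁻¹ 0, σ⁻¹ 1, σ⁻¹ 2` are a permutation of `0, 1, 2`, whose sum is `0` in `Fin 3`
  have key : ∀ τ : Equiv.Perm (Fin 3), hcThird (τ 0) (τ 2) = τ 1 := by decide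
  exact key σ.symm

/-- **The Cayley point of a partner is a partner of the Cayley point**: on the wall `s w₀ 0 = s w₀ 2`,
`hcCayPt w₀ k₀ k₂ (slotPerm ρ s) = slotPerm (update ρ w₀ 1) (cayPt w₀ s)` (`k₀, k₂` as above). [cite: Shelstad1979, Lemma 4.3 (p. 25)] -/
theorem hcCayPt_slotPerm_eq (ρ : W → Equiv.Perm (Fin 3)) {s : W → Fin 3 → ℝ} {w₀ : W} (hs : s w₀ 0 = s w₀ 2) :
    hcCayPt w₀ ((ρ w₀).symm 0) ((ρ w₀).symm 2) (slotPerm ρ s) = slotPerm (Function.update ρ w₀ 1) (cayPt w₀ s) := by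
  have hwall : slotPerm ρ s w₀ ((ρ w₀).symm 0) = slotPerm ρ s w₀ ((ρ w₀).symm 2) := by
    rw [slotPerm_apply, slotPerm_apply, Equiv.apply_symm_apply, Equiv.apply_symm_apply, hs]
  rw [hcCayPt_eq_of_wall hwall, cayPt_eq_update_of_wall hs, hcThird_symm_zero_symm_two]
  funext v j
  by_cases hv : v = w₀
  · subst hv
    simp only [Function.update_self, slotPerm_apply, Equiv.Perm.coe_one, id_eq, Equiv.apply_symm_apply]
  · simp only [Function.update_of_ne hv, slotPerm_apply]

end Comb


/-! ## §2 The resolved form of the partner sum on an admissible chart (★ κ-TABLE: `Δ″ = K_ρ · τ · D` on the partner points) -/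

section Resolved

variable (L : Type) [Field L] [NumberField L] [IsCMField L] (α : Fin 3 → L) (μ : HeckeCharacter L)
  (F : Finset {w : InfinitePlace L // IsComplex w} → ({w : InfinitePlace L // IsComplex w} → Fin 3 → ℝ) → ℂ)

/-- **RESOLVED FORM OF THE PARTNER SUM on an ADMISSIBLE chart** (`S ⊆ splitChartPlaces`): the `Δ″`-weights factor as `K_ρ · τ(γ_H)·D_{G∕H,∞}(γ_H)` with the SLOT constant
`K_ρ = Π_w slotSign L α w (ρ_w⁻¹ 1) · η_w ∈ {±1}` (★ `archExplicitDelta_endoTorus_gprimeTorus_slotPerm_eq_mul`), so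
`transfFamReg S c = R_S(c) · w_S · (τ·D)(endoTorus S c) · Σ_{ρ} K_ρ · F S (ρ·c) ∕ R′_S(ρ·c)` for EVERY `c` — the `H`-point enters the sum only through the scalar `(τ·D)(γ_H)`.
[cite: Rogawski1990, §4.9 p. 55; §14.6 p. 242; §4.3 (4.3.1) p. 43] [cite: Shelstad1979, Lemma 4.2 (p. 23)] -/
theorem transfFamReg_eq_mul_sum {S : Finset {w : InfinitePlace L // IsComplex w}} (hS : ∀ w ∈ S, w ∈ splitChartPlaces L α)
    (c : {w : InfinitePlace L // IsComplex w} → Fin 3 → ℝ) :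
    transfFamReg L α μ F S c =
      archRH S c * partnerWeight L α S *
        ((archTau L (endoTorus L S c) μ * (archWeylRatio L (endoTorus L S c) : ℂ)) *
          ∑ ρ ∈ partnerPerms S,
            ((∏ w : {w : InfinitePlace L // IsComplex w}, ((slotSign L α w ((ρ w).symm 1) : ℤ) * archMajoritySign L (Matrix.diagonal α) w) : ℤ) : ℂ) *
              (F S (slotPerm ρ c) / archRG S (slotPerm ρ c))) := by
  unfold transfFamReg
  congr 1
  rw [Finset.mul_sum]
  refine Finset.sum_congr rfl fun ρ hρ => ?_
  rw [archExplicitDelta_endoTorus_gprimeTorus_slotPerm_eq_mul L α μ c hS hρ]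
  ring

end Resolved

end Literature.NumberTheory.Rogawski1990

end
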